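import Summits.BirchSwinnertonDyer.Rank1Residual.X11b.AnticyclotomicLevelStructure
import Summits.BirchSwinnertonDyer.Rank1Residual.Additive.KimThreeKummerCartesian
import Literature.NumberTheory.EllipticCurves.LocalKummerMap
import Literature.NumberTheory.GaloisCohomology.KolyvaginSystems
import HarnessLib

/-!
# The idle local conditions of the count (C): `loc_ℓ` VANISHES on `R_m[p^t]` (classes of level
# `p^m` killed by `p^t` come from level `p^t`, whose local Kummer classes are `p^{m−t}`-multiples)
# and on `p^j · Sel` once `p^j` kills the local Kummer condition (cell `b2b-bsdres`, CLASS-CLOSURE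
# lane, class O10 — x1b GEN 37, class lead; file 64 of the series: the discharge of input (v) of
# file 63 `DefectCountFiniteLevel.relIndex_mul_prime_pow_eq_card_mul_prod`)

HONEST FRAMING (cell `b2b-bsdres`, run/shared/lean/b2b/bsd-rank1-residual/, verbatim in every
file): the goal of the cell is to DELETE the COMBINATION-SHAPED residual classes of the
Birch–Swinnerton-Dyer formula for ALL analytic-rank `≤ 1` elliptic curves over `ℚ` — "full BSD
formula for every rank `≤ 1` curve in class `C`" assembled STRICTLY from published theorems — so
that the rank-`≤ 1` remainder becomes exactly the CONSTRUCTION-SHAPED classes, which are TYPED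
(missing-input `Prop`s), NOT attempted. This is not "finishing BSD". CLASS-CLOSURE lane: prove
what is provable now; shrink each hard class to its core with data; no claim beyond stated classes;
research routes on CONSTRUCTION-SHAPED X12 / O10; census / instrument output = EVIDENCE / conjecture
items, NEVER a Literature fact; `RESIDUAL-MAP.md` marks change only by signed lines. THIS FILE:
TOOL THEOREMS ONLY — no definition, no named Literature fact, no Summits-side fact `def … : Prop`,
no `sorry`, axioms standard; the divisibility of `E(K̄)` (`hdiv`, a PROVED tree fact,
`zsmul_geomPoints_surjective_holds`) and "no `Γ_K`-invariant `p`-power torsion" (`hΓ`, i.e.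
`E(K)[p] = 0`) are hypotheses; nothing is booked; no label / mark / count / sub-cell moves; (C1_η),
(C2_η-GZ), (C3_η) stay typed as filed (cc-typer-6's pen); O10 stays OPEN / CONSTRUCTION-SHAPED;
nothing about `BSD(W, p)` of any pair is claimed.

## What (x1b GEN 36 note §2; GEN 37 files 60–63)

Input (v) of the finite-level count (file 63) asks that `loc_ℓ` send `R_m[p^t]` (`R_m` the Kummer
structure of `E[p^m]` relaxed at `v₀`) and `p^{m−t−ν} κ_m(P)` into the transported dual conditions
`D_ℓ` at the bad places `ℓ ≠ v₀`.  Both images are in fact ZERO once `p^{m−t}` (resp. `p^{m−t−ν}`)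
kills the local Kummer condition `𝓚_{m,ℓ}` (a finite group of order `#E(K_ℓ)[p^m] · #(𝓞_ℓ/p^m)`,
tree `natCard_kummerSelmerStructure_inr`; at `ℓ ∤ p` this is `#E(K_ℓ)[p^∞]` for `m ≫ 0`):

* §2 the level maps `ι : E[d] ↪ E[N]` (`d ∣ N`; `z ∈ 𝓚_d ↔ ι_* z ∈ 𝓚_N` is n1011's
  `Additive.map_torsionInclusion_mem_kummerLocalConditionAt_iff`, functoriality `H¹(g) ∘ H¹(f) = H¹(h)`
  is `Additive.map_one_map_one_of_comp_eq`): `map_torsionInclusion_localKummerMap`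
  (**`ι_* κ_d(P) = κ_N((N/d) · P)`**, Milne I §6 proof of Prop. 6.9), hence
  `map_torsionInclusion_eq_zero_of_mem` (`ι_* 𝓚_d = 0` once `(N/d) · 𝓚_N = 0`).
* §3 `exists_map_torsionInclusion_eq_of_nsmul_eq_zero` — over `K` with `E[p^∞]^{Γ_K} = 0`:
  **`H¹(K, E[p^m])[p^t] = ι_* H¹(K, E[p^t])`** (through `E[p^∞]`: X11b `Levels`, image `= [p^t]`,
  injectivity).
* §4 **`localization_eq_zero_of_nsmul_eq_zero`** — `loc_v y = 0` for every `y ∈ H¹(K, E[p^m])` with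
  `p^t y = 0` and `loc_v y ∈ 𝓚_{m,v}`, provided `p^{m−t} 𝓚_{m,v} = 0`; `localization_nsmul_eq_zero` —
  `loc_v (p^j y) = 0` for `loc_v y ∈ 𝓚_{m,v}`, `p^j 𝓚_{m,v} = 0`; `nsmul_eq_zero_of_natCard_dvd` — the
  killing hypotheses from `#𝓚_{m,v} ∣ p^j`.  These discharge (v) of file 63 (any `D_ℓ ∋ 0`).

References: [MilneADT2006] I §6, proof of Prop. 6.9 (the maps `A_m → A_{m²}`), Lemma 3.3;
[GreenbergLNM1716] §2 p. 63, §5 proof of Prop. 5.8; Serre, *Galois Cohomology*, I.§2.2.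
-/

noncomputable section

open scoped Classical

universe u

open CategoryTheory Field Function NumberField IsDedekindDomain WeierstrassCurve
open Literature.NumberTheory.EllipticCurves
open Literature.NumberTheory.GaloisRepresentations
open Literature.NumberTheory.GaloisRepresentations.DiscreteGaloisModule (SelmerStructure localMap)
open Literature.NumberTheory.GaloisCohomology
open Summit.BirchSwinnertonDyer.Rank1Residual.X11b.Levels
open scoped ContRepresentation

namespace Summit.BirchSwinnertonDyer.Rank1Residual.Additive.KummerLevelStabilisation

/-! ## §2. The level maps `E[d] ↪ E[N]` on local Kummer conditions -/

section Local

variable {K : Type u} [Field K] [CharZero K] (W : WeierstrassCurve K) [W.IsElliptic]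
  (E : Type u) [Field E] [Algebra K E]

/-- **`ι_* κ_{E,d}(P) = κ_{E,N}((N/d) · P)`** on `E`-rational points: the level map
`ι : E[d] ↪ E[N]` sends the local Kummer class of `P` at level `d` to the local Kummer class of
`(N/d) · P` at level `N` (same root `Q`, `dQ = P`, `NQ = (N/d)P`). Milne, *ADT*, I §6, proof of
Prop. 6.9 ("`b_v ↦ b_{v,1}`"). [cite: MilneADT2006, I §6, proof of Prop. 6.9] -/
theorem map_torsionInclusion_localKummerMap {d N : ℤ} (h : d ∣ N) (hd : d ≠ 0) (hN : N ≠ 0)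
    (P : (W.baseChange E).toAffine.Point) :
    galoisCohomology.map ((W.torsionInclusion h).restrictField E) 1 (W.localKummerMap E hd P) =
      W.localKummerMap E hN ((N / d) • P) := by
  have hQ := W.zsmul_localZSMulRoot E hd P
  have hNQ : N • W.localZSMulRoot E hd P =
      W.baseChangeGeomPointsEquiv E (toGeomPoints (W.baseChange E) ((N / d) • P)) := by
    have hN' : N / d * d = N := Int.ediv_mul_cancel h
    rw [map_zsmul, map_zsmul, ← hQ, ← mul_zsmul, hN']
  have hfix := W.zsmul_mem_fixedPoints_of_eq E hNQ
  rw [W.localKummerMap_eq_localKummerClass E hN ((N / d) • P) _ hfix hNQ]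
  exact W.map_torsionInclusion_localKummerClass h hd hN _ _ hfix

/-- **`ι_* 𝓚_{E,d} = 0` once `(N/d) · 𝓚_{E,N} = 0`**: a class of the local Kummer condition at level
`d` is `κ_d(P)` (exactness of the local Kummer sequence, tree `range_localKummerMap`), and
`ι_* κ_d(P) = κ_N((N/d) · P) = (N/d) · κ_N(P)`. [cite: MilneADT2006, I §6, proof of Prop. 6.9] -/
theorem map_torsionInclusion_eq_zero_of_mem [CharZero E] {d N : ℤ} (h : d ∣ N) (hd : d ≠ 0)
    (hN : N ≠ 0) (hkill : ∀ x ∈ W.kummerLocalConditionAt N E, (N / d) • x = 0)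
    {z : galoisCohomology (GaloisRep.restrictField E (W.torsionGaloisModule d)) 1}
    (hz : z ∈ W.kummerLocalConditionAt d E) :
    galoisCohomology.map ((W.torsionInclusion h).restrictField E) 1 z = 0 := by
  rw [← W.range_localKummerMap E hd] at hz
  obtain ⟨P, rfl⟩ := hz
  rw [map_torsionInclusion_localKummerMap W E h hd hN P, map_zsmul]
  exact hkill _ (W.localKummerMap_mem E hN P)

end Local

/-! ## §3. Over `K`: classes of level `p^m` killed by `p^t` come from level `p^t` -/

section Global

variable {K : Type u} [Field K] (W : WeierstrassCurve K) (p : ℕ) [Fact p.Prime] [W.IsElliptic]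

omit [Fact p.Prime] [W.IsElliptic] in
/-- `E[p^t] ↪ E[p^m] ↪ E[p^∞]` is `E[p^t] ↪ E[p^∞]`. [folklore] -/
theorem primaryInclusion_torsionInclusion {t m : ℕ} (h : ((p ^ t : ℕ) : ℤ) ∣ ((p ^ m : ℕ) : ℤ))
    (P : W.geomTorsion ((p ^ t : ℕ) : ℤ)) :
    primaryInclusion W p m (W.torsionInclusion h P) = primaryInclusion W p t P :=
  Subtype.ext rfl

/-- **`H¹(K, E[p^m])[p^t] = ι_* H¹(K, E[p^t])`** for `t ≤ m` when `E[p^∞]^{Γ_K} = 0` (e.g.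
`E(K)[p] = 0`): a class `y` of level `p^m` killed by `p^t` maps into `H¹(K, E[p^∞])[p^t]`, which is
the image of level `p^t` (X11b `mem_range_map_primaryInclusion_iff`), and `H¹(K, E[p^m]) → H¹(K, E[p^∞])`
is injective (X11b `map_primaryInclusion_injective`). [cite: GreenbergLNM1716, §5 proof of Prop. 5.8]
[cite: MilneADT2006, I §6, proof of Prop. 6.9] -/
theorem exists_map_torsionInclusion_eq_of_nsmul_eq_zero (hdiv : W.zsmul_geomPoints_surjective)
    (hΓ : ∀ Q : W.geomPrimaryTorsion p,
      (∀ σ : absoluteGaloisGroup K, X11b.LocBridge.primaryGaloisModule W p σ Q = Q) → Q = 0)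
    {t m : ℕ} (h : ((p ^ t : ℕ) : ℤ) ∣ ((p ^ m : ℕ) : ℤ))
    (y : galoisCohomology (W.torsionGaloisModule ((p ^ m : ℕ) : ℤ)) 1) (hy : p ^ t • y = 0) :
    ∃ y' : galoisCohomology (W.torsionGaloisModule ((p ^ t : ℕ) : ℤ)) 1,
      galoisCohomology.map (W.torsionInclusion h) 1 y' = y := by
  have hmem : galoisCohomology.map (primaryInclusion W p m) 1 y ∈
      (galoisCohomology.map (primaryInclusion W p t) 1).range := by
    rw [mem_range_map_primaryInclusion_iff W p t hdiv, ← map_nsmul, hy, map_zero]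
  obtain ⟨y', hy'⟩ := hmem
  refine ⟨y', map_primaryInclusion_injective W p m hΓ ?_⟩
  rw [map_one_map_one_of_comp_eq _ _ (primaryInclusion W p t) (primaryInclusion_torsionInclusion W p h),
    hy']

end Global

/-! ## §4. `loc_v` vanishes on `R_m[p^t]` and on `p^j · R_m` -/

section Vanishing

variable {K : Type u} [Field K] [NumberField K] (W : WeierstrassCurve K) (p : ℕ) [Fact p.Prime]
  [W.IsElliptic]

/-- An element of a subgroup whose order divides `c` is killed by `c` (Lagrange). [folklore] -/
theorem nsmul_eq_zero_of_natCard_dvd {A : Type*} [AddCommGroup A] (L : AddSubgroup A) {c : ℕ}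
    (hc : Nat.card L ∣ c) {x : A} (hx : x ∈ L) : c • x = 0 := by
  have h1 : addOrderOf (⟨x, hx⟩ : L) ∣ c := (addOrderOf_dvd_natCard _).trans hc
  have h2 : c • (⟨x, hx⟩ : L) = 0 := addOrderOf_dvd_iff_nsmul_eq_zero.mp h1
  exact congrArg Subtype.val h2

/-- **`loc_v y = 0` for `y ∈ H¹(K, E[p^m])` with `p^t · y = 0` and `loc_v y ∈ 𝓚_{m,v}`, provided
`p^{m−t}` kills `𝓚_{m,v}`** (`t ≤ m`, `E[p^∞]^{Γ_K} = 0`): `y = ι_* y'` of level `p^t` (§3),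
`loc_v y = ι_* loc_v y'` (naturality of localisation), `loc_v y' ∈ 𝓚_{t,v}` (§2), and
`ι_* 𝓚_{t,v} = p^{m−t} · 𝓚_{m,v} = 0`.  This is input (v), first half, of file 63: `loc_ℓ(R_m[p^t]) = 0`
at every place `ℓ` where `R_m` carries the Kummer condition.
[cite: MilneADT2006, I §6, proof of Prop. 6.9] [cite: GreenbergLNM1716, §5 proof of Prop. 5.8] -/
theorem localization_eq_zero_of_nsmul_eq_zero (hdiv : W.zsmul_geomPoints_surjective)
    (hΓ : ∀ Q : W.geomPrimaryTorsion p,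
      (∀ σ : absoluteGaloisGroup K, X11b.LocBridge.primaryGaloisModule W p σ Q = Q) → Q = 0)
    {t m : ℕ} (htm : t ≤ m) (v : Place K) [CharZero (Place.Completion v)]
    (hkill : ∀ x ∈ W.kummerSelmerStructure ((p ^ m : ℕ) : ℤ) v, p ^ (m - t) • x = 0)
    {y : galoisCohomology (W.torsionGaloisModule ((p ^ m : ℕ) : ℤ)) 1} (hy : p ^ t • y = 0)
    (hyv : galoisCohomology.localization (W.torsionGaloisModule ((p ^ m : ℕ) : ℤ)) v 1 y ∈
      W.kummerSelmerStructure ((p ^ m : ℕ) : ℤ) v) :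
    galoisCohomology.localization (W.torsionGaloisModule ((p ^ m : ℕ) : ℤ)) v 1 y = 0 := by
  have hp : p.Prime := Fact.out
  have h : ((p ^ t : ℕ) : ℤ) ∣ ((p ^ m : ℕ) : ℤ) := by exact_mod_cast pow_dvd_pow p htm
  have hd : ((p ^ t : ℕ) : ℤ) ≠ 0 := by exact_mod_cast pow_ne_zero t hp.ne_zero
  have hN : ((p ^ m : ℕ) : ℤ) ≠ 0 := by exact_mod_cast pow_ne_zero m hp.ne_zero
  obtain ⟨y', rfl⟩ := exists_map_torsionInclusion_eq_of_nsmul_eq_zero W p hdiv hΓ h y hy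
  rw [localization_map_one] at hyv ⊢
  rw [kummerSelmerStructure_apply] at hyv hkill
  have hy'v : galoisCohomology.localization (W.torsionGaloisModule ((p ^ t : ℕ) : ℤ)) v 1 y' ∈
      W.kummerLocalConditionAt ((p ^ t : ℕ) : ℤ) (Place.Completion v) :=
    (map_torsionInclusion_mem_kummerLocalConditionAt_iff W (Place.Completion v) h _).mp hyv
  refine map_torsionInclusion_eq_zero_of_mem W (Place.Completion v) h hd hN (fun x hx => ?_) hy'v
  have hq : ((p ^ m : ℕ) : ℤ) / ((p ^ t : ℕ) : ℤ) = ((p ^ (m - t) : ℕ) : ℤ) := by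
    have hm : ((p ^ m : ℕ) : ℤ) = ((p ^ t : ℕ) : ℤ) * ((p ^ (m - t) : ℕ) : ℤ) := by
      rw [← Nat.cast_mul, ← pow_add, Nat.add_sub_cancel' htm]
    rw [hm, Int.mul_ediv_cancel_left _ hd]
  rw [hq, natCast_zsmul]
  exact hkill x hx

omit [Fact p.Prime] [W.IsElliptic] in
/-- **`loc_v (p^j · y) = 0` when `loc_v y ∈ 𝓚_{n,v}` and `p^j` kills `𝓚_{n,v}`** — input (v), second
half, of file 63 (`loc_ℓ (p^{m−t−ν} κ_m(P)) = 0`). [cite: MilneADT2006, I Lemma 3.3] -/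
theorem localization_nsmul_eq_zero {n : ℤ} (v : Place K) {j : ℕ}
    (hkill : ∀ x ∈ W.kummerSelmerStructure n v, p ^ j • x = 0)
    {y : galoisCohomology (W.torsionGaloisModule n) 1}
    (hyv : galoisCohomology.localization (W.torsionGaloisModule n) v 1 y ∈ W.kummerSelmerStructure n v) :
    galoisCohomology.localization (W.torsionGaloisModule n) v 1 (p ^ j • y) = 0 := by
  rw [map_nsmul]
  exact hkill _ hyv

/-- **Input (v) of the finite-level count (file 63) DISCHARGED**: for the Kummer structure `𝓚` of
`E[p^m]`, a finite place `w₀`, a finite set `T` of finite places not containing `w₀`, the relaxed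
Selmer group `R = H¹_{𝓚[w₀ ↦ ⊤]}`, a Selmer class `g`, and ANY family of local conditions `D_w`
(`w ∈ T`): if `E[p^∞]^{Γ_K} = 0` and `p^{m−t−ν}` kills `𝓚_{m,w}` at every `w ∈ T` (`t + ν ≤ m`), then
`loc_w` sends `{y ∈ R | p^t y = 0}` and `p^{m−t−ν} g` into `D_w` — indeed to `0`.
[cite: MilneADT2006, I §6, proof of Prop. 6.9] [cite: GreenbergLNM1716, §5 proof of Prop. 5.8] -/
theorem idle_local_conditions (hdiv : W.zsmul_geomPoints_surjective)
    (hΓ : ∀ Q : W.geomPrimaryTorsion p,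
      (∀ σ : absoluteGaloisGroup K, X11b.LocBridge.primaryGaloisModule W p σ Q = Q) → Q = 0)
    {t m ν : ℕ} (htν : t + ν ≤ m) (w₀ : HeightOneSpectrum (𝓞 K))
    (T : Finset (HeightOneSpectrum (𝓞 K))) (hw₀T : w₀ ∉ T)
    (hkill : ∀ w ∈ T, ∀ x ∈ W.kummerSelmerStructure ((p ^ m : ℕ) : ℤ) (Sum.inr w),
      p ^ (m - t - ν) • x = 0)
    (D : ∀ w : ↥T, AddSubgroup (galoisCohomology ((W.torsionGaloisModule ((p ^ m : ℕ) : ℤ)).toLocal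
      (Sum.inr (w : HeightOneSpectrum (𝓞 K)))) 1))
    {g : galoisCohomology (W.torsionGaloisModule ((p ^ m : ℕ) : ℤ)) 1}
    (hg : g ∈ (W.kummerSelmerStructure ((p ^ m : ℕ) : ℤ) :
      SelmerStructure (W.torsionGaloisModule ((p ^ m : ℕ) : ℤ))).selmerGroup) :
    (∀ w : ↥T, ∀ y ∈ (SelmerStructure.selmerGroup (Function.update
        (W.kummerSelmerStructure ((p ^ m : ℕ) : ℤ)) (Sum.inr w₀) ⊤ :
          SelmerStructure (W.torsionGaloisModule ((p ^ m : ℕ) : ℤ)))),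
      p ^ t • y = 0 →
        galoisCohomology.localization (W.torsionGaloisModule ((p ^ m : ℕ) : ℤ))
          (Sum.inr (w : HeightOneSpectrum (𝓞 K))) 1 y ∈ D w) ∧
    (∀ w : ↥T, galoisCohomology.localization (W.torsionGaloisModule ((p ^ m : ℕ) : ℤ))
        (Sum.inr (w : HeightOneSpectrum (𝓞 K))) 1 (p ^ (m - t - ν) • g) ∈ D w) := by
  -- at `w ∈ T`, `p^{m-t}` kills `𝓚_{m,w}` as well
  have hkill' : ∀ w ∈ T, ∀ x ∈ W.kummerSelmerStructure ((p ^ m : ℕ) : ℤ) (Sum.inr w),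
      p ^ (m - t) • x = 0 := fun w hw x hx => by
    have hmt : m - t = ν + (m - t - ν) := by omega
    rw [hmt, pow_add, mul_nsmul', hkill w hw x hx, nsmul_zero]
  have hne : ∀ w : ↥T, (Sum.inr (w : HeightOneSpectrum (𝓞 K)) : Place K) ≠ Sum.inr w₀ :=
    fun w h => hw₀T ((Sum.inr_injective h) ▸ w.2)
  refine ⟨fun w y hy hpy => ?_, fun w => ?_⟩
  · haveI : CharZero (Place.Completion (Sum.inr (w : HeightOneSpectrum (𝓞 K)) : Place K)) :=
      charZero_adicCompletion (w : HeightOneSpectrum (𝓞 K))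
    have hyv : galoisCohomology.localization (W.torsionGaloisModule ((p ^ m : ℕ) : ℤ))
        (Sum.inr (w : HeightOneSpectrum (𝓞 K))) 1 y ∈
          W.kummerSelmerStructure ((p ^ m : ℕ) : ℤ) (Sum.inr (w : HeightOneSpectrum (𝓞 K))) := by
      have h := (SelmerStructure.mem_selmerGroup_iff _ y).mp hy (Sum.inr (w : HeightOneSpectrum (𝓞 K)))
      rw [Function.update_of_ne (hne w)] at h
      exact h
    rw [localization_eq_zero_of_nsmul_eq_zero W p hdiv hΓ (by omega : t ≤ m) _ (hkill' w w.2) hpy hyv]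
    exact zero_mem _
  · have hgv : galoisCohomology.localization (W.torsionGaloisModule ((p ^ m : ℕ) : ℤ))
        (Sum.inr (w : HeightOneSpectrum (𝓞 K))) 1 g ∈
          W.kummerSelmerStructure ((p ^ m : ℕ) : ℤ) (Sum.inr (w : HeightOneSpectrum (𝓞 K))) :=
      (SelmerStructure.mem_selmerGroup_iff _ g).mp hg _
    rw [localization_nsmul_eq_zero W p _ (hkill w w.2) hgv]
    exact zero_mem _

end Vanishing

end Summit.BirchSwinnertonDyer.Rank1Residual.Additive.KummerLevelStabilisation

end
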